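import Summits.KontsevichZagierPeriods.KontsevichZagierPeriods.Theorems.HurwitzMicroSectorsNormalFormPrincipleLevelOne
import Summits.KontsevichZagierPeriods.KontsevichZagierPeriods.Theorems.HurwitzMicroSectorsNormalFormPrincipleSlabASubPtK20
import Summits.KontsevichZagierPeriods.KontsevichZagierPeriods.Theorems.HurwitzMicroSectorsNormalFormPrincipleAlgCarriers
import Summits.KontsevichZagierPeriods.KontsevichZagierPeriods.Theorems.HurwitzMicroSectorsNormalFormPrincipleM2FiveZetaTwo

/-!
# `NormalFormPrinciple` (stmt-KontsevichZagierPeriods-3869), line `SketchIdeator1` — leaf `stub_boxRigidity`: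
# level two with real-algebraic coefficients: the representations of the pipeline exist

Registered sub-goal `levelTwo_exists_reps` of the layer `AlgLevelTwo` (level two
`[(0,1)², P/(1 − x²y²)]` with `P ∈ (ℚ̄ ∩ ℝ)[x,y]`). For a real algebraic coefficient `c`
(`IsAlgebraic ℚ c`) the three shapes of honest Kontsevich–Zagier integral representations met
along the level-two pipeline exist, with LITERAL domains and integrands:

* the level-two monomial box `[(0,1)², c·x₀^a x₁^b/(1 − x₀²x₁²)]`: `ℚ`-semialgebraic as the product
  of the algebraic constant `c` (`isSemialgebraicFunOn_const_of_isAlgebraic`) and a quotient of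
  `ℚ`-polynomials (`1 − x₀²x₁² > 0` on the box); absolutely convergent by DOMINATION from level one:
  on the box `0 < 1 − x₀x₁ ≤ 1 − x₀²x₁²`, so
  `|c·x₀^a x₁^b/(1 − x₀²x₁²)| ≤ |c·x₀^a x₁^b/(1 − x₀x₁)|`, and the right-hand side is integrable by
  Beukers' integral for `ζ(2)` (seat c7's `LevelOne.integrableOn_aeval_div_one_sub_mul`, the real
  constant factored out);
* the triangle `[{0 < z₀ < 1, 0 ≤ z₁ ≤ z₀}, c·z₀^{a−b−1} z₁^b/(1 − z₁²)]` — the image of the box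
  monomial under the merge gadget `(x₀, x₁) ↦ (x₀, x₀x₁)` (rule 2) — again dominated by the
  level-one triangle integrand (`0 < 1 − z₁ ≤ 1 − z₁²` on the triangle,
  `LevelOne.integrableOn_triangleIntegrand`);
* the dimension-one box `[(0,1), (c/n)·x₀^b (Σ_{i<n} x₀^i)/(1 + x₀)]` (any `n`, with `c/0 = 0`):
  a quotient of `ℚ`-polynomials times the algebraic constant `c/n`, continuous on the compact
  interval `[0,1] ⊇ (0,1)` since `1 + x₀ ≥ 1` there.

References: M. Kontsevich, D. Zagier, *Periods* (2001), §1.1–1.2; F. Beukers, *A note on the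
irrationality of ζ(2) and ζ(3)*, Bull. LMS 11 (1979). No new definitions.
-/

noncomputable section

open MeasureTheory Set
open Literature.NumberTheory.Transcendental Literature.NumberTheory.Transcendental.KZ
open Literature.ModelTheory.ExponentialFields (IsSemialgebraic)

namespace Summit.KontsevichZagierPeriods.HurwitzMicroSectors.NormalFormPrinciple.PiBox.AlgLevelTwo

/-! ## The level-two monomial box -/

/-- On the open unit box of `ℝ²` the level-two denominator dominates the level-one denominator:
`0 < 1 − x₀x₁ ≤ 1 − x₀²x₁²` (since `0 ≤ x₀x₁ < 1` gives `(x₀x₁)² ≤ x₀x₁`). [folklore] -/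
theorem lt2e_box_denominator_bounds {x : Fin 2 → ℝ} (hx : ∀ i, x i ∈ Set.Ioo (0:ℝ) 1) :
    0 < 1 - x 0 * x 1 ∧ 1 - x 0 * x 1 ≤ 1 - x 0 ^ 2 * x 1 ^ 2 := by
  have h0 := hx 0
  have h1 := hx 1
  have hp : 0 ≤ x 0 * x 1 := mul_nonneg h0.1.le h1.1.le
  have hlt : x 0 * x 1 < 1 := mul_lt_one_of_nonneg_of_lt_one_left h0.1.le h0.2 h1.2.le
  have hsq : (x 0 * x 1) ^ 2 ≤ x 0 * x 1 := pow_le_of_le_one hp hlt.le two_ne_zero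
  rw [mul_pow] at hsq
  exact ⟨sub_pos.2 hlt, by linarith⟩

/-- **Semialgebraicity of the level-two monomial integrand with an algebraic coefficient.**
`x ↦ c·x₀^a x₁^b/(1 − x₀²x₁²)` is `ℚ`-semialgebraic on the open unit box for real algebraic `c`:
the constant `c` is `ℚ`-semialgebraic (`isSemialgebraicFunOn_const_of_isAlgebraic`) and so is the
quotient of `ℚ`-polynomials `x₀^a x₁^b/(1 − x₀²x₁²)`, whose denominator is positive on the box.
[cite: KontsevichZagier2001, §1.1] -/
theorem lt2e_isSemialgebraicFunOn_boxIntegrand (a b : ℕ) {c : ℝ} (hc : IsAlgebraic ℚ c) :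
    IsSemialgebraicFunOn ℚ {x : Fin 2 → ℝ | ∀ i, x i ∈ Set.Ioo (0:ℝ) 1}
      (fun x => c * (x 0 ^ a * x 1 ^ b) / (1 - x 0 ^ 2 * x 1 ^ 2)) := by
  refine (IsSemialgebraicFunOn.mul_holds
    (isSemialgebraicFunOn_const_of_isAlgebraic (isSemialgebraic_box 2) hc)
    (isSemialgebraicFunOn_aeval_div_aeval (isSemialgebraic_box 2)
      (MvPolynomial.X 0 ^ a * MvPolynomial.X 1 ^ b)
      (1 - MvPolynomial.X 0 ^ 2 * MvPolynomial.X 1 ^ 2) fun x hx => ?_)).congr fun x _ => ?_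
  · have h := lt2e_box_denominator_bounds hx
    simp only [map_sub, map_one, map_mul, map_pow, MvPolynomial.aeval_X]
    exact (h.1.trans_le h.2).ne'
  · simp only [Pi.mul_apply, map_sub, map_one, map_mul, map_pow, MvPolynomial.aeval_X]
    ring

/-- **Absolute convergence of the level-two monomial integrand with a real coefficient**:
`c·x₀^a x₁^b/(1 − x₀²x₁²)` is integrable on the open unit box — it is measurable and dominated in
absolute value by the level-one integrand `c·x₀^a x₁^b/(1 − x₀x₁)` (`0 < 1 − x₀x₁ ≤ 1 − x₀²x₁²`),
which is integrable by Beukers' double integral for `ζ(2)` (seat c7's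
`LevelOne.integrableOn_aeval_div_one_sub_mul`, the constant factored out).
[cite: KontsevichZagier2001, §1.1] -/
theorem lt2e_integrableOn_boxIntegrand (a b : ℕ) (c : ℝ) :
    IntegrableOn (fun x : Fin 2 → ℝ => c * (x 0 ^ a * x 1 ^ b) / (1 - x 0 ^ 2 * x 1 ^ 2))
      {x | ∀ i, x i ∈ Set.Ioo (0:ℝ) 1} := by
  have hA : MeasurableSet {x : Fin 2 → ℝ | ∀ i, x i ∈ Set.Ioo (0:ℝ) 1} :=
    IsSemialgebraic.measurableSet_holds (isSemialgebraic_box 2)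
  have h1 : IntegrableOn (fun x : Fin 2 → ℝ => c * (x 0 ^ a * x 1 ^ b) / (1 - x 0 * x 1))
      {x | ∀ i, x i ∈ Set.Ioo (0:ℝ) 1} := by
    have h := (LevelOne.integrableOn_aeval_div_one_sub_mul
      (MvPolynomial.X 0 ^ a * MvPolynomial.X 1 ^ b)).const_mul c
    have e : (fun x : Fin 2 → ℝ => c * (x 0 ^ a * x 1 ^ b) / (1 - x 0 * x 1)) =
        fun x : Fin 2 → ℝ => c * ((MvPolynomial.aeval x
          (MvPolynomial.X 0 ^ a * MvPolynomial.X 1 ^ b : MvPolynomial (Fin 2) ℚ) : ℝ) /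
            (1 - x 0 * x 1)) := by
      funext x
      simp only [map_mul, map_pow, MvPolynomial.aeval_X]
      ring
    rw [e]
    exact h
  refine Integrable.mono h1 (Measurable.aestronglyMeasurable (by fun_prop))
    (ae_restrict_of_forall_mem hA fun x hx => ?_)
  have hb := lt2e_box_denominator_bounds hx
  rw [Real.norm_eq_abs, Real.norm_eq_abs, abs_div, abs_div, abs_of_pos hb.1,
    abs_of_pos (hb.1.trans_le hb.2)]
  exact div_le_div_of_nonneg_left (abs_nonneg _) hb.1 hb.2

/-- **The level-two monomial box with an algebraic coefficient exists**:
`[(0,1)², c·x₀^a x₁^b/(1 − x₀²x₁²)]` is an integral representation for real algebraic `c`.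
[cite: KontsevichZagier2001, §1.1] -/
theorem lt2e_exists_boxRep (a b : ℕ) {c : ℝ} (hc : IsAlgebraic ℚ c) :
    ∃ N : IntegralRep 2, N.domain = {x | ∀ i, x i ∈ Set.Ioo (0:ℝ) 1} ∧
      N.integrand = fun x => c * (x 0 ^ a * x 1 ^ b) / (1 - x 0 ^ 2 * x 1 ^ 2) :=
  ⟨⟨_, _, isSemialgebraic_box 2, lt2e_isSemialgebraicFunOn_boxIntegrand a b hc,
    lt2e_integrableOn_boxIntegrand a b c⟩, rfl, rfl⟩

/-! ## The triangle -/

/-- On the triangle `T = {0 < z₀ < 1, 0 ≤ z₁ ≤ z₀}` the level-two denominator dominates the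
level-one denominator: `0 < 1 − z₁ ≤ 1 − z₁²` (since `0 ≤ z₁ < 1` gives `z₁² ≤ z₁`). [folklore] -/
theorem lt2e_triangle_denominator_bounds {z : Fin 2 → ℝ}
    (hz : z ∈ KZlog.band {y : Fin 1 → ℝ | 0 < y 0 ∧ y 0 < 1} (fun _ => (0:ℝ)) (fun y => y 0)) :
    0 < 1 - z 1 ∧ 1 - z 1 ≤ 1 - z 1 ^ 2 := by
  have h : (0 < z 0 ∧ z 0 < 1) ∧ 0 ≤ z 1 ∧ z 1 ≤ z 0 := hz
  have h1 : z 1 < 1 := h.2.2.trans_lt h.1.2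
  have hp : z 1 ^ 2 ≤ z 1 := pow_le_of_le_one h.2.1 h1.le two_ne_zero
  exact ⟨sub_pos.2 h1, by linarith⟩

/-- **Semialgebraicity of the level-two triangle integrand with an algebraic coefficient.**
`z ↦ c·z₀^{a−b−1} z₁^b/(1 − z₁²)` is `ℚ`-semialgebraic on the triangle `{0 < z₀ < 1, 0 ≤ z₁ ≤ z₀}`
for real algebraic `c`: the algebraic constant times a quotient of `ℚ`-polynomials whose
denominator `1 − z₁² ≥ 1 − z₁ ≥ 1 − z₀ > 0` does not vanish there.
[cite: KontsevichZagier2001, §1.1] -/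
theorem lt2e_isSemialgebraicFunOn_triangleIntegrand (a b : ℕ) {c : ℝ} (hc : IsAlgebraic ℚ c) :
    IsSemialgebraicFunOn ℚ
      (KZlog.band {y : Fin 1 → ℝ | 0 < y 0 ∧ y 0 < 1} (fun _ => (0:ℝ)) (fun y => y 0))
      (fun z => c * (z 0 ^ (a - b - 1) * z 1 ^ b) / (1 - z 1 ^ 2)) := by
  refine (IsSemialgebraicFunOn.mul_holds
    (isSemialgebraicFunOn_const_of_isAlgebraic LevelOne.isSemialgebraic_triangleBand hc)
    (isSemialgebraicFunOn_aeval_div_aeval LevelOne.isSemialgebraic_triangleBand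
      (MvPolynomial.X 0 ^ (a - b - 1) * MvPolynomial.X 1 ^ b) (1 - MvPolynomial.X 1 ^ 2)
      fun z hz => ?_)).congr fun z _ => ?_
  · have h := lt2e_triangle_denominator_bounds hz
    simp only [map_sub, map_one, map_pow, MvPolynomial.aeval_X]
    exact (h.1.trans_le h.2).ne'
  · simp only [Pi.mul_apply, map_sub, map_one, map_mul, map_pow, MvPolynomial.aeval_X]
    ring

/-- **Absolute convergence of the level-two triangle integrand with a real coefficient**:
`c·z₀^{a−b−1} z₁^b/(1 − z₁²)` is integrable on the triangle, by domination from level one: on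
`T`, `|c·z₀^{a−b−1} z₁^b/(1 − z₁²)| ≤ |c·z₀^{a−b−1} z₁^b/(1 − z₁)|`, and the right-hand side is
integrable (seat c7's `LevelOne.integrableOn_triangleIntegrand`, Beukers' integral transported
through the merge chart `(x₀, x₁) ↦ (x₀, x₀x₁)`, the constant factored out).
[cite: KontsevichZagier2001, §1.2 rule (2)] -/
theorem lt2e_integrableOn_triangleIntegrand (a b : ℕ) (c : ℝ) :
    IntegrableOn (fun z : Fin 2 → ℝ => c * (z 0 ^ (a - b - 1) * z 1 ^ b) / (1 - z 1 ^ 2))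
      (KZlog.band {y : Fin 1 → ℝ | 0 < y 0 ∧ y 0 < 1} (fun _ => (0:ℝ)) (fun y => y 0)) := by
  have hTm : MeasurableSet
      (KZlog.band {y : Fin 1 → ℝ | 0 < y 0 ∧ y 0 < 1} (fun _ => (0:ℝ)) (fun y => y 0)) :=
    IsSemialgebraic.measurableSet_holds LevelOne.isSemialgebraic_triangleBand
  have h1 : IntegrableOn (fun z : Fin 2 → ℝ => c * (z 0 ^ (a - b - 1) * z 1 ^ b) / (1 - z 1))
      (KZlog.band {y : Fin 1 → ℝ | 0 < y 0 ∧ y 0 < 1} (fun _ => (0:ℝ)) (fun y => y 0)) := by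
    have h := (LevelOne.integrableOn_triangleIntegrand a b 1).const_mul c
    have e : (fun z : Fin 2 → ℝ => c * (z 0 ^ (a - b - 1) * z 1 ^ b) / (1 - z 1)) =
        fun z : Fin 2 → ℝ => c * (((1 : ℚ) : ℝ) * (z 0 ^ (a - b - 1) * z 1 ^ b) / (1 - z 1)) := by
      funext z
      rw [Rat.cast_one, one_mul, mul_div_assoc]
    rw [e]
    exact h
  refine Integrable.mono h1 (Measurable.aestronglyMeasurable (by fun_prop))
    (ae_restrict_of_forall_mem hTm fun z hz => ?_)
  have h := lt2e_triangle_denominator_bounds hz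
  rw [Real.norm_eq_abs, Real.norm_eq_abs, abs_div, abs_div, abs_of_pos h.1,
    abs_of_pos (h.1.trans_le h.2)]
  exact div_le_div_of_nonneg_left (abs_nonneg _) h.1 h.2

/-- **The level-two triangle representation with an algebraic coefficient exists**:
`[{0 < z₀ < 1, 0 ≤ z₁ ≤ z₀}, c·z₀^{a−b−1} z₁^b/(1 − z₁²)]` is an integral representation for real
algebraic `c` — the image of the box monomial `c·x₀^a x₁^b/(1 − x₀²x₁²)` (`a > b`) under the merge
gadget `u = x₀x₁`. [cite: KontsevichZagier2001, §1.2 rule (2)] -/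
theorem lt2e_exists_triangleRep (a b : ℕ) {c : ℝ} (hc : IsAlgebraic ℚ c) :
    ∃ R : IntegralRep 2,
      R.domain = KZlog.band {y : Fin 1 → ℝ | 0 < y 0 ∧ y 0 < 1} (fun _ => (0:ℝ)) (fun y => y 0) ∧
      R.integrand = fun z => c * (z 0 ^ (a - b - 1) * z 1 ^ b) / (1 - z 1 ^ 2) :=
  ⟨⟨_, _, LevelOne.isSemialgebraic_triangleBand,
    lt2e_isSemialgebraicFunOn_triangleIntegrand a b hc,
    lt2e_integrableOn_triangleIntegrand a b c⟩, rfl, rfl⟩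

/-! ## The dimension-one box -/

/-- **The dimension-one box of the level-two pipeline with an algebraic coefficient exists**:
`[(0,1), (c/n)·x₀^b (Σ_{i<n} x₀^i)/(1 + x₀)]` is an integral representation for real algebraic `c`
and every `n` (the constant `c/n` is algebraic, `c/0 = 0`; the rational factor is a quotient of
`ℚ`-polynomials with denominator `1 + x₀ > 0`, continuous on the compact interval `[0,1] ⊇ (0,1)`).
[cite: KontsevichZagier2001, §1.1] -/
theorem lt2e_exists_dimOneRep (b n : ℕ) {c : ℝ} (hc : IsAlgebraic ℚ c) :
    ∃ N₁ : IntegralRep 1, N₁.domain = {x | ∀ i, x i ∈ Set.Ioo (0:ℝ) 1} ∧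
      N₁.integrand = fun x =>
        c / (n : ℝ) * (x 0 ^ b * ∑ i ∈ Finset.range n, x 0 ^ i) / (1 + x 0) := by
  have hB := isSemialgebraic_box 1
  have hcn : IsAlgebraic ℚ (c / (n : ℝ)) := by
    rw [div_eq_mul_inv]
    exact hc.mul (isAlgebraic_nat n).inv
  have hsa : IsSemialgebraicFunOn ℚ {x : Fin 1 → ℝ | ∀ i, x i ∈ Set.Ioo (0:ℝ) 1}
      (fun x => c / (n : ℝ) * (x 0 ^ b * ∑ i ∈ Finset.range n, x 0 ^ i) / (1 + x 0)) := by
    refine (IsSemialgebraicFunOn.mul_holds (isSemialgebraicFunOn_const_of_isAlgebraic hB hcn)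
      (isSemialgebraicFunOn_aeval_div_aeval hB
        (MvPolynomial.X 0 ^ b * ∑ i ∈ Finset.range n, MvPolynomial.X 0 ^ i)
        (1 + MvPolynomial.X 0) fun x hx => ?_)).congr fun x _ => ?_
    · have h0 : 0 < x 0 := (hx 0).1
      simp only [map_add, map_one, MvPolynomial.aeval_X]
      exact (show (0:ℝ) < 1 + x 0 by linarith).ne'
    · simp only [Pi.mul_apply, map_mul, map_pow, map_sum, map_add, map_one, MvPolynomial.aeval_X]
      ring
  have hcont : ContinuousOn (fun x : Fin 1 → ℝ =>
      c / (n : ℝ) * (x 0 ^ b * ∑ i ∈ Finset.range n, x 0 ^ i) / (1 + x 0)) (Set.Icc 0 1) := by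
    refine ContinuousOn.div (by fun_prop) (by fun_prop) fun x hx => ?_
    have h0 : 0 ≤ x 0 := hx.1 0
    exact (show (0:ℝ) < 1 + x 0 by linarith).ne'
  have hint : IntegrableOn
      (fun x : Fin 1 → ℝ => c / (n : ℝ) * (x 0 ^ b * ∑ i ∈ Finset.range n, x 0 ^ i) / (1 + x 0))
      {x | ∀ i, x i ∈ Set.Ioo (0:ℝ) 1} :=
    hcont.integrableOn_Icc.mono_set fun _ hx => ⟨fun j => (hx j).1.le, fun j => (hx j).2.le⟩
  exact ⟨⟨_, _, hB, hsa, hint⟩, rfl, rfl⟩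

/-! ## The registered sub-goal -/

/-- **Stub T5 (existence of the representations of the algebraic level-two pipeline; registered
sub-goal `levelTwo_exists_reps` of stmt-KontsevichZagierPeriods-3869).** For a real algebraic
coefficient `c`, the level-two monomial box `[(0,1)², c·x₀^a x₁^b/(1 − x₀²x₁²)]`, the triangle
`[{0 < z₀ < 1, 0 ≤ z₁ ≤ z₀}, c·z₀^{a−b−1} z₁^b/(1 − z₁²)]` (`b < a`, the image under the merge
gadget `u = x₀x₁`, rule 2) and the dimension-one box `[(0,1), (c/n)·x₀^b (Σ_{i<n} x₀^i)/(1 + x₀)]`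
(the result of integrating out `z₀`, rule 3) all exist as integral representations of the
Kontsevich–Zagier calculus, with literally these domains and integrands.
[cite: KontsevichZagier2001, §1.2] -/
theorem levelTwo_exists_reps (c : ℝ) (hc : IsAlgebraic ℚ c) :
    (∀ (a b : ℕ), ∃ N : IntegralRep 2, N.domain = {x | ∀ i, x i ∈ Set.Ioo (0:ℝ) 1} ∧
      N.integrand = fun x => c * (x 0 ^ a * x 1 ^ b) / (1 - x 0 ^ 2 * x 1 ^ 2)) ∧
    (∀ (a b : ℕ), b < a → ∃ R : IntegralRep 2,
      R.domain = KZlog.band {y : Fin 1 → ℝ | 0 < y 0 ∧ y 0 < 1} (fun _ => (0:ℝ)) (fun y => y 0) ∧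
      R.integrand = fun z => c * (z 0 ^ (a - b - 1) * z 1 ^ b) / (1 - z 1 ^ 2)) ∧
    (∀ (b n : ℕ), ∃ N₁ : IntegralRep 1, N₁.domain = {x | ∀ i, x i ∈ Set.Ioo (0:ℝ) 1} ∧
      N₁.integrand = fun x => c / (n : ℝ) * (x 0 ^ b * ∑ i ∈ Finset.range n, x 0 ^ i) / (1 + x 0))
    := by
  exact ⟨fun a b => lt2e_exists_boxRep a b hc, fun a b _ => lt2e_exists_triangleRep a b hc,
    fun b n => lt2e_exists_dimOneRep b n hc⟩

end Summit.KontsevichZagierPeriods.HurwitzMicroSectors.NormalFormPrinciple.PiBox.AlgLevelTwo
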